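import Summits.AtomisticToContinuum.BoseEinsteinCondensation.Theorems.StaticResponseBound.Negative.Basic
import Summits.AtomisticToContinuum.BoseEinsteinCondensation.Theorems.BECInsertionCorrectorStaticResponseBoundModInfTranslate
import HarnessLib

/-!
# Order-theoretic facts on the modulated ground-state energy (stub `stub_modInfBasic`)

Stub `stub_modInfBasic` of line `uv-thomson-force-wave` of the crux
`BECInsertionCorrector.StaticResponseBound` (item stmt-AtomisticToContinuum-12057; this file supports,
does not close, the item).

For a pair potential `w`, particle number `N`, side `L` and wave vector `k` (momentum `p = 2πk/L`) the
line's skeleton works with the MODULATED GROUND-STATE ENERGY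

  `E(s) = ⨅ {E_w(Φ).toReal + s ⟨∑ⱼ cos(p·xⱼ)⟩_Φ : Φ periodic trial state, E_w(Φ) ≠ ⊤}`,

a real (conditionally complete) infimum over the subtype of finite-energy periodic trial states.  We
prove the three elementary order facts the glue `modulationBound_of_curvature` needs:

* (P1) `E(s)` is below every member of the family (`ciInf_le`; the family is bounded below by
  `-|s| N` — `bddBelow_range_energy_add_mul_cosMean` of the landed sibling file
  `…StaticResponseBoundModInfTranslate.lean`, from `abs_cosMean_le`);
* (P2) `E(0) = E₀.toReal` (the infimum of the energies over all states equals the infimum over the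
  finite-energy states, the others being `⊤`; then `ENNReal.toReal_iInf`);
* (P3) `s ↦ E(s)` is `N`-Lipschitz when `E₀ ≠ ⊤` (each member is `N`-Lipschitz in `s`; the subtype
  is nonempty because `E₀ ≠ ⊤`, so `le_ciInf` applies).

Everything is folklore order theory over `ℝ` plus the tree lemmas `abs_cosMean_le`,
`bddBelow_range_energy_add_mul_cosMean` and the variational principle `iInf_le`.
-/

noncomputable section

namespace Summit.AtomisticToContinuum.BoseEinsteinCondensation.Cruxes.StaticResponseBound.UvThomsonForceWave

open MeasureTheory Filter
open scoped ENNReal NNReal BigOperators Topology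
open Literature.MathematicalPhysics.QuantumManyBody.BoseGas
open Summit.AtomisticToContinuum.BoseEinsteinCondensation.Theses.BECInsertionCorrector
open Summit.AtomisticToContinuum.BoseEinsteinCondensation.Theorems.StaticResponseBound.Negative

variable {N : ℕ} {L : ℝ}

/-! ## The members of the family -/

/-- Each member of the modulated family is `N`-Lipschitz in the coupling:
`E_w(Φ).toReal + s ⟨∑cos⟩_Φ ≤ E_w(Φ).toReal + s' ⟨∑cos⟩_Φ + N |s - s'|`. [folklore] -/
theorem modInfBasic_member_lipschitz (w : ℝ → ℝ≥0∞) (k : Fin 3 → ℤ) (s s' : ℝ)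
    (Φ : PeriodicTrialState N L) :
    (periodicEnergy w Φ).toReal + s * cosMean L k Φ ≤
      (periodicEnergy w Φ).toReal + s' * cosMean L k Φ + N * |s - s'| := by
  have h1 : |(s - s') * cosMean L k Φ| ≤ |s - s'| * N := by
    rw [abs_mul]
    exact mul_le_mul_of_nonneg_left (abs_cosMean_le k Φ) (abs_nonneg _)
  have h2 := le_abs_self ((s - s') * cosMean L k Φ)
  linarith

/-! ## (P1) the infimum is below every member -/

/-- (P1) The modulated ground-state energy is below every finite-energy member of the family. [folklore] -/
theorem modInfBasic_le (w : ℝ → ℝ≥0∞) (k : Fin 3 → ℤ) (s : ℝ) (Ψ : PeriodicTrialState N L)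
    (hΨ : periodicEnergy w Ψ ≠ ⊤) :
    (⨅ Φ : {Φ : PeriodicTrialState N L // periodicEnergy w Φ ≠ ⊤},
        ((periodicEnergy w Φ.1).toReal + s * cosMean L k Φ.1)) ≤
      (periodicEnergy w Ψ).toReal + s * cosMean L k Ψ :=
  ciInf_le (bddBelow_range_energy_add_mul_cosMean w k s) ⟨Ψ, hΨ⟩

/-! ## (P2) the value at zero coupling -/

/-- The infimum of the energies over the finite-energy states is the ground-state energy (the other
states have energy `⊤`). [folklore] -/
theorem modInfBasic_iInf_subtype_eq (w : ℝ → ℝ≥0∞) :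
    (⨅ Φ : {Φ : PeriodicTrialState N L // periodicEnergy w Φ ≠ ⊤}, periodicEnergy w Φ.1) =
      periodicGroundStateEnergy w N L := by
  unfold periodicGroundStateEnergy
  refine le_antisymm (le_iInf fun Ψ => ?_) (le_iInf fun Φ => iInf_le _ Φ.1)
  by_cases hΨ : periodicEnergy w Ψ = ⊤
  · rw [hΨ]
    exact le_top
  · exact iInf_le (fun Φ : {Φ : PeriodicTrialState N L // periodicEnergy w Φ ≠ ⊤} =>
      periodicEnergy w Φ.1) ⟨Ψ, hΨ⟩

/-- (P2) The real infimum of `E_w(Φ).toReal` over the finite-energy states is `E₀.toReal`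
(`ENNReal.toReal_iInf`; both sides are the junk `0` when there is no finite-energy state). [folklore] -/
theorem modInfBasic_iInf_toReal (w : ℝ → ℝ≥0∞) :
    (⨅ Φ : {Φ : PeriodicTrialState N L // periodicEnergy w Φ ≠ ⊤}, (periodicEnergy w Φ.1).toReal) =
      (periodicGroundStateEnergy w N L).toReal := by
  rw [← modInfBasic_iInf_subtype_eq w,
    ENNReal.toReal_iInf fun Φ : {Φ : PeriodicTrialState N L // periodicEnergy w Φ ≠ ⊤} => Φ.2]

/-! ## (P3) Lipschitz continuity in the coupling -/

/-- If `E₀ ≠ ⊤` there is a finite-energy periodic trial state. [folklore] -/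
theorem modInfBasic_nonempty (w : ℝ → ℝ≥0∞) (h : periodicGroundStateEnergy w N L ≠ ⊤) :
    Nonempty {Φ : PeriodicTrialState N L // periodicEnergy w Φ ≠ ⊤} := by
  by_contra hne
  apply h
  unfold periodicGroundStateEnergy
  refine iInf_eq_top.2 fun Ψ => ?_
  by_contra hΨ
  exact hne ⟨⟨Ψ, hΨ⟩⟩

/-- (P3, one-sided) `E(s) - E(s') ≤ N |s - s'|` as soon as there is a finite-energy state. [folklore] -/
theorem modInfBasic_sub_le (w : ℝ → ℝ≥0∞) (k : Fin 3 → ℤ)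
    (hne : Nonempty {Φ : PeriodicTrialState N L // periodicEnergy w Φ ≠ ⊤}) (s s' : ℝ) :
    (⨅ Φ : {Φ : PeriodicTrialState N L // periodicEnergy w Φ ≠ ⊤},
        ((periodicEnergy w Φ.1).toReal + s * cosMean L k Φ.1)) -
      (⨅ Φ : {Φ : PeriodicTrialState N L // periodicEnergy w Φ ≠ ⊤},
        ((periodicEnergy w Φ.1).toReal + s' * cosMean L k Φ.1)) ≤ N * |s - s'| := by
  haveI := hne
  rw [sub_le_comm]
  refine le_ciInf fun Φ => ?_
  have h1 : (⨅ Φ : {Φ : PeriodicTrialState N L // periodicEnergy w Φ ≠ ⊤},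
      ((periodicEnergy w Φ.1).toReal + s * cosMean L k Φ.1)) ≤
        (periodicEnergy w Φ.1).toReal + s * cosMean L k Φ.1 :=
    ciInf_le (bddBelow_range_energy_add_mul_cosMean w k s) Φ
  have h2 := modInfBasic_member_lipschitz w k s s' Φ.1
  linarith

/-! ## The registered stub -/

/-- **Stub `stub_modInfBasic`** (line `uv-thomson-force-wave`, crux `BECInsertionCorrector.StaticResponseBound`,
item stmt-AtomisticToContinuum-12057): the three order-theoretic facts about the modulated ground-state energy
`E(s) = ⨅ {E_w(Φ).toReal + s⟨∑ⱼcos(p·xⱼ)⟩_Φ : Φ finite energy}` — (P1) it is below every finite-energy member,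
(P2) `E(0) = E₀.toReal` when `E₀ ≠ ⊤`, (P3) it is `N`-Lipschitz in `s` when `E₀ ≠ ⊤`. [folklore] -/
theorem stub_modInfBasic :
    ∀ (w : ℝ → ℝ≥0∞) (N : ℕ) (L : ℝ), 0 < L → ∀ k : Fin 3 → ℤ,
      (∀ (s : ℝ) (Ψ : PeriodicTrialState N L), periodicEnergy w Ψ ≠ ⊤ →
        (⨅ Φ : {Φ : PeriodicTrialState N L // periodicEnergy w Φ ≠ ⊤},
            ((periodicEnergy w Φ.1).toReal + s * cosMean L k Φ.1)) ≤
          (periodicEnergy w Ψ).toReal + s * cosMean L k Ψ) ∧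
      (periodicGroundStateEnergy w N L ≠ ⊤ →
        (⨅ Φ : {Φ : PeriodicTrialState N L // periodicEnergy w Φ ≠ ⊤},
            ((periodicEnergy w Φ.1).toReal + 0 * cosMean L k Φ.1)) =
          (periodicGroundStateEnergy w N L).toReal) ∧
      (periodicGroundStateEnergy w N L ≠ ⊤ → ∀ s s' : ℝ,
        |(⨅ Φ : {Φ : PeriodicTrialState N L // periodicEnergy w Φ ≠ ⊤},
              ((periodicEnergy w Φ.1).toReal + s * cosMean L k Φ.1)) -
            (⨅ Φ : {Φ : PeriodicTrialState N L // periodicEnergy w Φ ≠ ⊤},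
              ((periodicEnergy w Φ.1).toReal + s' * cosMean L k Φ.1))| ≤ N * |s - s'|) := by
  intro w N L _ k
  refine ⟨fun s Ψ hΨ => modInfBasic_le w k s Ψ hΨ, fun _ => ?_, fun hE s s' => ?_⟩
  · simp only [zero_mul, add_zero]
    exact modInfBasic_iInf_toReal w
  · have hne := modInfBasic_nonempty w hE
    rw [abs_sub_le_iff]
    refine ⟨modInfBasic_sub_le w k hne s s', ?_⟩
    rw [abs_sub_comm]
    exact modInfBasic_sub_le w k hne s' s

end Summit.AtomisticToContinuum.BoseEinsteinCondensation.Cruxes.StaticResponseBound.UvThomsonForceWave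

end
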